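import Summits.QuantumFields.BalabanUV.T4Continuum.Spine.NE2.DeltaPrimeCatalogue
import Summits.QuantumFields.BalabanUV.T4Continuum.Spine.NE2BalabanHodge
import Summits.QuantumFields.BalabanUV.T4Continuum.Spine.NE2.AdjointFieldInstance

/-!
# T⁴ programme, spine node NE2 (U1a) — ROOT B's HODGE-FORM END PLUS THE COMMUTATOR BLOCK OF (3.10)'s `Δ′` AT THE ADJOINT TRANSPORTERS: rate `L⁻¹`
# (repair R13, the assembled rate for everything typed so far; residual r1 of the dictionary B0)

Cell `pub-balaban-gaps` (track G2, seat ne2 = spine estimate NE2; census `run/shared/lean/pub/pub-balaban-gaps/ne/NE2.md` §5 R13/R15, §10).  With `Spine/NE2/DictionaryB0`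
(«Hodge-form tier-B operator = principal part of [B9] (3.26) + free averaging term», exact), `Spine/NE2/DeltaPrimeOperator` ((3.10)'s `Δ′` typed) and
`Spine/NE2/DeltaPrimeCatalogue` (`perturbationLaws_deltaPrime₂`: the target shape for `Δ′`'s commutator block from bounded, two-level consistent catalogue fields),
THIS FILE (i) gives the generic CONSISTENCY FEED for the catalogue fields — **`DeltaPrimeCatalogue.boundedBackgroundM_pairField`** (three-factor telescoping
`norm_triple_sub_le`: contractive outer factors, `‖B‖ ≤ b`, and two-level consistency of the three factors READ AT THE SHIFTED SITES against the block parent ⟹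
`BoundedBackgroundM … b (bρl + σ + bρr)`) with its definitional specialisations **`boundedBackgroundM_zF`**/**`boundedBackgroundM_zB`**, and the reduction **`shifted_consistent`** («shifted block-parent consistency ⇐ consistency +
lattice-Lipschitz», `RegularBackgroundTower.par_sub_unitVec_cases`) — so the displayed hypotheses are exactly node NE3's two-level consistency and the (3.35)–(3.36)
lattice-Lipschitz shapes ON THE DATA `Ad ∘ V`, `Bfield ∘ V`; and (ii) adds the laws (`PerturbationAlgebra.perturbationLaws_add`) to the Hodge-form tier-B law `NE2BalabanHodge.perturbationLaws_balaban_hodge` taken AT THE ADJOINT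
SITE TRANSPORTERS `Rb := adRep hF ∘ V` (`Spine/NE2/AdjointFieldInstance.adRep`, p342816) of a `U(N)`-valued bond-field tower `V` and runs the engine `NE2ColourPerturbedLayer.towerLimitRate_perturbed_king_kron`:
 * `kappaDP2`, `CDP2` (the collapsed finite-sum constants of `perturbationLaws_deltaPrime₂`; `perturbationLaws_deltaPrime₂'`);
 * **`balaban_hodge_deltaPrime₂_rate`**: for every coupling `t` with `‖t‖·(κ_H + κ₂) < 1`,
   `TowerLimitRate (Qlev ⊗ 1) L^d (k ↦ (Δ_a^{(k)} ⊗ 1 + t·(P_B(Ad V) k + hodgeCorr(Ad V) k + Δ′₂(V) k))⁻¹) (Cpert (κ_H + κ₂) (2dCst) CJ (C₂^H + C₂′) 0 t) L⁻¹` —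
   displayed binders: `RegularSites (Ad ∘ V) α β β₂` ((3.35)+(3.36) shapes), node NE3's `LocalRate` on `regClass₂` BY NAME (OPEN), `0 < a′`, the B4 thresholds, the
   mixed-shift `ShiftLaws`, `BoundedBackgroundM` of the `Δ′₂` catalogue fields (size half = `DeltaPrimeCatalogue.norm_zF_zB_le`; consistency half = NE3's currency) —
   NOTHING ELSE.  By `DictionaryB0.hodgeTierB_eq_principalB9` the operator is print's `Δ_a(U)` (3.26) at `R = Ad V` MINUS the second-order block of `Δ′` and the
   averaging residual (r2): the closest typed operator to print's so far.
HONEST FRAMING (T4-DAG p. 1).  Composition BY NAME at MODEL LEVEL (`V`, `e`, `c` DATA; hypothesis structures displayed; nothing printed is a hypothesis or a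
conclusion); NOT asserted: that `V` is Bałaban's minimiser, that the displayed structures hold for it (node NE3), the second-order block of `Δ′`, the [B7]
averaging; NE2 (U1a) NOT PROVED; spine PROVED 0/9 unchanged; NOT continuum YM / infinite volume / mass gap / Clay.  HONEST DEPENDENCY: continuum YM on T⁴ ⇐
BetaPertH ∧ nine spine estimates (0/9 proved); BetaPertH ⇐ (D1) ∧ (D4) ∧ CAP+tail; G-an2-4 gates asym, D1 and NE2/3/4.  No `sorry`; two constant `def`s only.
-/

noncomputable section

open scoped BigOperators ComplexConjugate Matrix




namespace Summit.QuantumFields.BalabanUV.T4Continuum.NE2.DeltaPrimeCatalogue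

open scoped Kronecker Matrix.Norms.L2Operator
open Literature.MathematicalPhysics.QuantumFieldTheory.Balaban1983to89.B5Prop11Plancherel (Tor fine unitVec)
open Literature.MathematicalPhysics.QuantumFieldTheory.Balaban1983to89.B5G183RateUnitTower (lev lev_neZero)
open Summit.QuantumFields.BalabanUV.T4Continuum.BalabanAveragedTowerUnit (idx one_le_lev')
open Summit.QuantumFields.BalabanUV.T4Continuum.BalabanAveragedTowerModes (par)
open Summit.QuantumFields.BalabanUV.T4Continuum.BlockPairingGeometry (parT)
open Summit.QuantumFields.BalabanUV.T4Continuum.ColourCovariantLaplacian (BoundedBackgroundM)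
open Summit.QuantumFields.BalabanUV.T4Continuum.NE2.DeltaPrimeOperator

/-! ## The consistency feed: `BoundedBackgroundM` of a pair-field tower from size + SHIFTED block-parent consistency of its three factors -/

section Feed

variable {n : Type} [Fintype n] [DecidableEq n] {ι : Type} [Fintype ι] [DecidableEq ι] {d : ℕ} (L : ℕ) [NeZero L] (M : Fin d → ℕ) [hM : ∀ μ, NeZero (M μ)]

omit hM in
/-- three-factor telescoping: `‖A′B′C′ − ABC‖ ≤ ‖A′ − A‖‖B′‖‖C′‖ + ‖A‖‖B′ − B‖‖C′‖ + ‖A‖‖B‖‖C′ − C‖`. [folklore] -/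
theorem norm_triple_sub_le (A A' B B' C C' : Matrix ι ι ℂ) :
    ‖A' * B' * C' - A * B * C‖ ≤ ‖A' - A‖ * ‖B'‖ * ‖C'‖ + ‖A‖ * ‖B' - B‖ * ‖C'‖ + ‖A‖ * ‖B‖ * ‖C' - C‖ := by
  have e : A' * B' * C' - A * B * C = (A' - A) * B' * C' + A * (B' - B) * C' + A * B * (C' - C) := by
    simp only [Matrix.sub_mul, Matrix.mul_sub]; abel
  rw [e]
  calc _ ≤ ‖(A' - A) * B' * C'‖ + ‖A * (B' - B) * C'‖ + ‖A * B * (C' - C)‖ := norm_add₃_le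
    _ ≤ _ := by
      refine add_le_add (add_le_add ?_ ?_) ?_
      · exact (Matrix.l2_opNorm_mul _ _).trans (mul_le_mul_of_nonneg_right (Matrix.l2_opNorm_mul _ _) (norm_nonneg _))
      · exact (Matrix.l2_opNorm_mul _ _).trans (mul_le_mul_of_nonneg_right (Matrix.l2_opNorm_mul _ _) (norm_nonneg _))
      · exact (Matrix.l2_opNorm_mul _ _).trans (mul_le_mul_of_nonneg_right (Matrix.l2_opNorm_mul _ _) (norm_nonneg _))

omit hM in
/-- **THE FEED (generic)**: a tower of pair fields `y ↦ [slot = κl]·Rl_k(y − δ_k)ᵀ·B_k(y − δ_k)·Rr_k(y − δ_k)` lies in `BoundedBackgroundM … b (bρl + σ + bρr)` as soon as the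
factors are contractions / bounded by `b` and are two-level consistent WHEN READ AT THE SHIFTED SITES against the block parent:
`‖Rl_{k+1}(y − δ_{k+1})ᵀ − Rl_k(par y − δ_k)ᵀ‖ ≤ ρl/L^k` etc. (the shift bookkeeping `par(y − e^{(k+1)}) ∈ {par y, par y − e^{(k)}}` — consistency + lattice-Lipschitz of
the data, `HolonomyTowerRegular.parT_tau_cases_lev` — is left to the instance: these are the SHAPES node NE3 / (3.35)–(3.36) supply). [folklore] -/
theorem boundedBackgroundM_pairField {Rl B Rr : (k : ℕ) → Tor (fine (lev L k) M) → Matrix ι ι ℂ}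
    (δ : (k : ℕ) → Tor (fine (lev L k) M)) (κl : Fin d) {b ρl ρr σ : ℝ} (hb : 0 ≤ b) (hρl : 0 ≤ ρl) (hρr : 0 ≤ ρr) (hσ : 0 ≤ σ)
    (hl : ∀ k x, ‖(Rl k x)ᵀ‖ ≤ 1) (hr : ∀ k x, ‖Rr k x‖ ≤ 1) (hBb : ∀ k x, ‖B k x‖ ≤ b)
    (hlc : ∀ k (y : Tor (fine (lev L (k + 1)) M)),
      ‖(Rl (k + 1) (y - δ (k + 1)))ᵀ - (Rl k (par (lev L k) L M y - δ k))ᵀ‖ ≤ ρl / (lev L k : ℕ))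
    (hBc : ∀ k (y : Tor (fine (lev L (k + 1)) M)), ‖B (k + 1) (y - δ (k + 1)) - B k (par (lev L k) L M y - δ k)‖ ≤ σ / (lev L k : ℕ))
    (hrc : ∀ k (y : Tor (fine (lev L (k + 1)) M)), ‖Rr (k + 1) (y - δ (k + 1)) - Rr k (par (lev L k) L M y - δ k)‖ ≤ ρr / (lev L k : ℕ)) :
    BoundedBackgroundM L M (fun k => pairField (fine (lev L k) M) (Rl k) (B k) (Rr k) (δ k) κl) b (b * ρl + σ + b * ρr) where
  nonneg := ⟨hb, by positivity⟩
  bound := fun k i => norm_pairField_le _ hb (hl k) (hBb k) (hr k) i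
  consistent := fun k i => by
    have hn : (0 : ℝ) < (lev L k : ℕ) := by exact_mod_cast one_le_lev' L k
    obtain ⟨y, κ⟩ := i
    show ‖pairField (fine (lev L (k + 1)) M) (Rl (k + 1)) (B (k + 1)) (Rr (k + 1)) (δ (k + 1)) κl (y, κ)
        - pairField (fine (lev L k) M) (Rl k) (B k) (Rr k) (δ k) κl (par (lev L k) L M y, κ)‖ ≤ (b * ρl + σ + b * ρr) / (lev L k : ℕ)
    unfold pairField
    by_cases hκ : κ = κl
    · simp only [hκ, if_true]
      refine (norm_triple_sub_le _ _ _ _ _ _).trans ?_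
      have h1 := hlc k y
      have h2 := hBc k y
      have h3 := hrc k y
      have hB' := hBb (k + 1) (y - δ (k + 1))
      have hC' := hr (k + 1) (y - δ (k + 1))
      have hA := hl k (par (lev L k) L M y - δ k)
      have hB := hBb k (par (lev L k) L M y - δ k)
      calc ‖(Rl (k + 1) (y - δ (k + 1)))ᵀ - (Rl k (par (lev L k) L M y - δ k))ᵀ‖ * ‖B (k + 1) (y - δ (k + 1))‖ * ‖Rr (k + 1) (y - δ (k + 1))‖
            + ‖(Rl k (par (lev L k) L M y - δ k))ᵀ‖ * ‖B (k + 1) (y - δ (k + 1)) - B k (par (lev L k) L M y - δ k)‖ * ‖Rr (k + 1) (y - δ (k + 1))‖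
            + ‖(Rl k (par (lev L k) L M y - δ k))ᵀ‖ * ‖B k (par (lev L k) L M y - δ k)‖ * ‖Rr (k + 1) (y - δ (k + 1)) - Rr k (par (lev L k) L M y - δ k)‖
          ≤ ρl / (lev L k : ℕ) * b * 1 + 1 * (σ / (lev L k : ℕ)) * 1 + 1 * b * (ρr / (lev L k : ℕ)) := by
            refine add_le_add (add_le_add ?_ ?_) ?_
            · exact mul_le_mul (mul_le_mul h1 hB' (norm_nonneg _) (div_nonneg hρl hn.le)) hC' (norm_nonneg _) (by positivity)
            · exact mul_le_mul (mul_le_mul hA h2 (norm_nonneg _) zero_le_one) hC' (norm_nonneg _) (by positivity)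
            · exact mul_le_mul (mul_le_mul hA hB (norm_nonneg _) zero_le_one) h3 (norm_nonneg _) (by positivity)
        _ = (b * ρl + σ + b * ρr) / (lev L k : ℕ) := by field_simp
    · rw [if_neg hκ, if_neg hκ, sub_self, norm_zero]
      positivity

/-- **SHIFTED CONSISTENCY FROM CONSISTENCY + LATTICE-LIPSCHITZ** (site towers): if `‖X_{k+1}(y) − X_k(par y)‖ ≤ βc/L^k` and `‖X_k(x − e_λ) − X_k(x)‖ ≤ βl/L^k`, then for every
edge offset `δ_j ∈ {e_ν, 0, 0, e_μ}`: `‖X_{k+1}(y − δ_j) − X_k(par y − δ_j)‖ ≤ (βc + βl)/L^k` (the parent of a backward-shifted site is the parent or its backward shift,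
`RegularBackgroundTower.par_sub_unitVec_cases`). [folklore] -/
theorem shifted_consistent {X : (k : ℕ) → Tor (fine (lev L k) M) → Matrix ι ι ℂ} {βc βl : ℝ} (hβl : 0 ≤ βl)
    (hcons : ∀ k (y : Tor (fine (lev L (k + 1)) M)), ‖X (k + 1) y - X k (par (lev L k) L M y)‖ ≤ βc / (lev L k : ℕ))
    (hlip : ∀ k (lam : Fin d) (x : Tor (fine (lev L k) M)), ‖X k (x - unitVec (fine (lev L k) M) lam) - X k x‖ ≤ βl / (lev L k : ℕ))
    (μ ν : Fin d) (j : Fin 4) (k : ℕ) (y : Tor (fine (lev L (k + 1)) M)) :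
    ‖X (k + 1) (y - edgeOff (fine (lev L (k + 1)) M) μ ν j) - X k (par (lev L k) L M y - edgeOff (fine (lev L k) M) μ ν j)‖ ≤ (βc + βl) / (lev L k : ℕ) := by
  have hn : (0 : ℝ) < (lev L k : ℕ) := by exact_mod_cast one_le_lev' L k
  have hmono : βc / (lev L k : ℕ) ≤ (βc + βl) / (lev L k : ℕ) := div_le_div_of_nonneg_right (by linarith) hn.le
  -- the one-step case
  have step : ∀ lam : Fin d, ‖X (k + 1) (y - unitVec (fine (lev L (k + 1)) M) lam) - X k (par (lev L k) L M y - unitVec (fine (lev L k) M) lam)‖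
      ≤ (βc + βl) / (lev L k : ℕ) := by
    intro lam
    have hc := hcons k (y - unitVec (fine (lev L (k + 1)) M) lam)
    rcases RegularBackgroundTower.par_sub_unitVec_cases (lev L k) L M lam y with h | h
    · have h' : par (lev L k) L M (y - unitVec (fine (lev L (k + 1)) M) lam) = par (lev L k) L M y := h
      rw [h'] at hc
      calc _ ≤ ‖X (k + 1) (y - unitVec (fine (lev L (k + 1)) M) lam) - X k (par (lev L k) L M y)‖
              + ‖X k (par (lev L k) L M y) - X k (par (lev L k) L M y - unitVec (fine (lev L k) M) lam)‖ := norm_sub_le_norm_sub_add_norm_sub _ _ _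
        _ ≤ βc / (lev L k : ℕ) + βl / (lev L k : ℕ) := add_le_add hc (by rw [norm_sub_rev]; exact hlip k lam _)
        _ = (βc + βl) / (lev L k : ℕ) := by rw [add_div]
    · have h' : par (lev L k) L M (y - unitVec (fine (lev L (k + 1)) M) lam) = par (lev L k) L M y - unitVec (fine (lev L k) M) lam := h
      rw [h'] at hc
      exact hc.trans hmono
  fin_cases j
  · exact step ν
  · show ‖X (k + 1) (y - 0) - X k (par (lev L k) L M y - 0)‖ ≤ _
    rw [sub_zero, sub_zero]; exact (hcons k y).trans hmono
  · show ‖X (k + 1) (y - 0) - X k (par (lev L k) L M y - 0)‖ ≤ _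
    rw [sub_zero, sub_zero]; exact (hcons k y).trans hmono
  · exact step μ

variable (c : ℝ) (e : ι → Matrix n n ℂ)

omit hM in
/-- **THE FEED FOR THE FORWARD FIELDS `zF`** (definitional specialisation of `boundedBackgroundM_pairField`): contractive signed edge matrices (`norm_edgeR_le_one`), a
plaquette-field bound `‖B_k(x)‖ ≤ b`, and SHIFTED block-parent consistency of the three towers `x ↦ edgeR (V k) x μ ν j`, `Bfield (V k) μ ν`, read at `y − δ_j`.
The displayed consistency hypotheses are the shapes node NE3 / (3.35)–(3.36) must supply for Bałaban's field (R13 file 3). [folklore] -/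
theorem boundedBackgroundM_zF (V : (k : ℕ) → Fin d → Tor (fine (lev L k) M) → Matrix n n ℂ) (μ ν : Fin d) (jj : Fin 4 × Fin 4)
    {b ρl ρr σ : ℝ} (hb : 0 ≤ b) (hρl : 0 ≤ ρl) (hρr : 0 ≤ ρr) (hσ : 0 ≤ σ)
    (hl : ∀ k x, ‖(edgeR (fine (lev L k) M) c e (V k) x μ ν jj.1)ᵀ‖ ≤ 1) (hr : ∀ k x, ‖edgeR (fine (lev L k) M) c e (V k) x μ ν jj.2‖ ≤ 1)
    (hBb : ∀ k x, ‖Bfield (fine (lev L k) M) (lev L k) c e (V k) μ ν x‖ ≤ b)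
    (hlc : ∀ k (y : Tor (fine (lev L (k + 1)) M)),
      ‖(edgeR (fine (lev L (k + 1)) M) c e (V (k + 1)) (y - edgeOff (fine (lev L (k + 1)) M) μ ν jj.1) μ ν jj.1)ᵀ
        - (edgeR (fine (lev L k) M) c e (V k) (par (lev L k) L M y - edgeOff (fine (lev L k) M) μ ν jj.1) μ ν jj.1)ᵀ‖ ≤ ρl / (lev L k : ℕ))
    (hBc : ∀ k (y : Tor (fine (lev L (k + 1)) M)),
      ‖Bfield (fine (lev L (k + 1)) M) (lev L (k + 1)) c e (V (k + 1)) μ ν (y - edgeOff (fine (lev L (k + 1)) M) μ ν jj.1)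
        - Bfield (fine (lev L k) M) (lev L k) c e (V k) μ ν (par (lev L k) L M y - edgeOff (fine (lev L k) M) μ ν jj.1)‖ ≤ σ / (lev L k : ℕ))
    (hrc : ∀ k (y : Tor (fine (lev L (k + 1)) M)),
      ‖edgeR (fine (lev L (k + 1)) M) c e (V (k + 1)) (y - edgeOff (fine (lev L (k + 1)) M) μ ν jj.1) μ ν jj.2
        - edgeR (fine (lev L k) M) c e (V k) (par (lev L k) L M y - edgeOff (fine (lev L k) M) μ ν jj.1) μ ν jj.2‖ ≤ ρr / (lev L k : ℕ)) :
    BoundedBackgroundM L M (zF L M c e V μ ν jj) b (b * ρl + σ + b * ρr) :=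
  boundedBackgroundM_pairField L M (fun k => edgeOff (fine (lev L k) M) μ ν jj.1) (edgeSlot μ ν jj.1) hb hρl hρr hσ hl hr hBb hlc hBc hrc

omit hM in
/-- **THE FEED FOR THE BACKWARD FIELDS `zB`** (the transposed-partner terms: `Rl = edgeR j′`, `B ↦ Bᵀ`, `Rr = edgeR j`, offset/slot of `j′`), definitional
specialisation of `boundedBackgroundM_pairField`. [folklore] -/
theorem boundedBackgroundM_zB (V : (k : ℕ) → Fin d → Tor (fine (lev L k) M) → Matrix n n ℂ) (μ ν : Fin d) (jj : Fin 4 × Fin 4)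
    {b ρl ρr σ : ℝ} (hb : 0 ≤ b) (hρl : 0 ≤ ρl) (hρr : 0 ≤ ρr) (hσ : 0 ≤ σ)
    (hl : ∀ k x, ‖(edgeR (fine (lev L k) M) c e (V k) x μ ν jj.2)ᵀ‖ ≤ 1) (hr : ∀ k x, ‖edgeR (fine (lev L k) M) c e (V k) x μ ν jj.1‖ ≤ 1)
    (hBb : ∀ k x, ‖(Bfield (fine (lev L k) M) (lev L k) c e (V k) μ ν x)ᵀ‖ ≤ b)
    (hlc : ∀ k (y : Tor (fine (lev L (k + 1)) M)),
      ‖(edgeR (fine (lev L (k + 1)) M) c e (V (k + 1)) (y - edgeOff (fine (lev L (k + 1)) M) μ ν jj.2) μ ν jj.2)ᵀ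
        - (edgeR (fine (lev L k) M) c e (V k) (par (lev L k) L M y - edgeOff (fine (lev L k) M) μ ν jj.2) μ ν jj.2)ᵀ‖ ≤ ρl / (lev L k : ℕ))
    (hBc : ∀ k (y : Tor (fine (lev L (k + 1)) M)),
      ‖(Bfield (fine (lev L (k + 1)) M) (lev L (k + 1)) c e (V (k + 1)) μ ν (y - edgeOff (fine (lev L (k + 1)) M) μ ν jj.2))ᵀ
        - (Bfield (fine (lev L k) M) (lev L k) c e (V k) μ ν (par (lev L k) L M y - edgeOff (fine (lev L k) M) μ ν jj.2))ᵀ‖ ≤ σ / (lev L k : ℕ))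
    (hrc : ∀ k (y : Tor (fine (lev L (k + 1)) M)),
      ‖edgeR (fine (lev L (k + 1)) M) c e (V (k + 1)) (y - edgeOff (fine (lev L (k + 1)) M) μ ν jj.2) μ ν jj.1
        - edgeR (fine (lev L k) M) c e (V k) (par (lev L k) L M y - edgeOff (fine (lev L k) M) μ ν jj.2) μ ν jj.1‖ ≤ ρr / (lev L k : ℕ)) :
    BoundedBackgroundM L M (zB L M c e V μ ν jj) b (b * ρl + σ + b * ρr) :=
  boundedBackgroundM_pairField L M (fun k => edgeOff (fine (lev L k) M) μ ν jj.2) (edgeSlot μ ν jj.2) hb hρl hρr hσ hl hr hBb hlc hBc hrc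

end Feed

end Summit.QuantumFields.BalabanUV.T4Continuum.NE2.DeltaPrimeCatalogue

namespace Summit.QuantumFields.BalabanUV.T4Continuum.NE2.DeltaPrimeHodgeRate

open scoped Kronecker Matrix.Norms.L2Operator
open Literature.MathematicalPhysics.QuantumFieldTheory.Balaban1983to89.B5Prop11Plancherel (Tor fine shiftM Cst Cst_nonneg)
open Literature.MathematicalPhysics.QuantumFieldTheory.Balaban1983to89.B5G183RateUnitTower (lev lev_neZero)
open Literature.MathematicalPhysics.QuantumFieldTheory.Balaban1983to89.T4EtaRateMin (LocalRate)
open Summit.QuantumFields.BalabanUV.T4Continuum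
open Summit.QuantumFields.BalabanUV.T4Continuum.BalabanAveragedTowerUnit (idx Qlev)
open Summit.QuantumFields.BalabanUV.T4Continuum.CovariantAveragingTower (TowerLimitRate)
open Summit.QuantumFields.BalabanUV.T4Continuum.BackgroundResolventTower (PerturbationLaws Cpert)
open Summit.QuantumFields.BalabanUV.T4Continuum.KingPairingPlantedLaw (calDalev JpcT CJ)
open Summit.QuantumFields.BalabanUV.T4Continuum.TransportedSiteAveraging (Dc Jc)
open Summit.QuantumFields.BalabanUV.T4Continuum.ColourCovariantLaplacian (BoundedBackgroundM)
open Summit.QuantumFields.BalabanUV.T4Continuum.PerturbationAlgebra (perturbationLaws_add perturbationLaws_mono)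
open Summit.QuantumFields.BalabanUV.T4Continuum.NE2FromNE3 (bgReadings)
open Summit.QuantumFields.BalabanUV.T4Continuum.RegularBackgroundTower (betaNE3)
open Summit.QuantumFields.BalabanUV.T4Continuum.ShiftedZerothOrder (ShiftLaws)
open Summit.QuantumFields.BalabanUV.T4Continuum.HodgeCorrectionLaws (hodgeCorr)
open Summit.QuantumFields.BalabanUV.T4Continuum.HolonomyTowerRegular (RegularSites regClass₂)
open Summit.QuantumFields.BalabanUV.T4Continuum.GaugeTermPerturbationLaw (deltaK)
open Summit.QuantumFields.BalabanUV.T4Continuum.GaugeTermScalarData (QuT Q1)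
open Summit.QuantumFields.BalabanUV.T4Continuum.GaugeTermInstanceGeom (gS)
open Summit.QuantumFields.BalabanUV.T4Continuum.ScalarAveragedCompression (sigma0)
open Summit.QuantumFields.BalabanUV.T4Continuum.ScalarCovariantLaplacian (kappaS)
open Summit.QuantumFields.BalabanUV.T4Continuum.RegularSiteTransporters (siteT)
open Summit.QuantumFields.BalabanUV.T4Continuum.NestedContourTransport (theta0)
open Summit.QuantumFields.BalabanUV.T4Continuum.CovariantAveragingSummand (kappaQ kappaQ_ofReal)
open Summit.QuantumFields.BalabanUV.T4Continuum.GramPerturbationLaw (C2gram)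
open Summit.QuantumFields.BalabanUV.T4Continuum.NE2BalabanRoot (balabanPert)
open Summit.QuantumFields.BalabanUV.T4Continuum.NE2BalabanGauge (gaugeSlot liftR)
open Summit.QuantumFields.BalabanUV.T4Continuum.NE2BalabanLayerSharp (kappaBs C2Bs)
open Summit.QuantumFields.BalabanUV.T4Continuum.NE2BalabanWiring (epsR CdeltaR)
open Summit.QuantumFields.BalabanUV.T4Continuum.NE2BalabanFinal (tauR kappa4F C4F)
open Summit.QuantumFields.BalabanUV.T4Continuum.NE2BalabanHodge (perturbationLaws_balaban_hodge)
open Summit.QuantumFields.BalabanUV.T4Continuum.NE2ColourPerturbedLayer (towerLimitRate_perturbed_king_kron)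
open Summit.QuantumFields.BalabanUV.Beta.AdjointCarrierWiring (adMat)
open Summit.QuantumFields.BalabanUV.Beta.AdjointCarrierWiringEnd (CompFamily)
open Summit.QuantumFields.BalabanUV.T4Continuum.NE2.AdjointFieldInstance (adRep)
open Summit.QuantumFields.BalabanUV.T4Continuum.NE2.DeltaPrimeOperator
open Summit.QuantumFields.BalabanUV.T4Continuum.NE2.DeltaPrimeCatalogue

variable {n : Type} [Fintype n] [DecidableEq n] {d : ℕ} {ι : Type} [Fintype ι] [DecidableEq ι]
variable (L : ℕ) [NeZero L] (M : Fin d → ℕ) [hM : ∀ μ, NeZero (M μ)] (a : ℝ) (ha : 0 < a) (c : ℝ) (e : ι → Matrix n n ℂ)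

/-- the rate constant of the zeroth-order block: `κ₂ = |dirPairs|·|orderedPairs|·α·Cst`. [folklore] -/
def kappaDP2 (d : ℕ) (a α : ℝ) : ℝ := ((dirPairs d).card : ℝ) * ((orderedPairs.card : ℝ) * (α * Cst d a))

/-- the consistency constant of the zeroth-order block: `C₂′ = |dirPairs|·|orderedPairs|·Cst·(2αCst + βCst)`. [folklore] -/
def CDP2 (d : ℕ) (a α β : ℝ) : ℝ := ((dirPairs d).card : ℝ) * ((orderedPairs.card : ℝ) * (Cst d a * (α * (2 * Cst d a) + β * Cst d a)))

/-- `perturbationLaws_deltaPrime₂` with its finite-sum constants collapsed (`Σ_q Σ_jj ½(x + x) = |dirPairs|·|orderedPairs|·x`). [folklore] -/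
theorem perturbationLaws_deltaPrime₂' (V : (k : ℕ) → Fin d → Tor (fine (lev L k) M) → Matrix n n ℂ) {α β : ℝ}
    (hF : ∀ μ ν jj, BoundedBackgroundM L M (zF L M c e V μ ν jj) α β) (hB : ∀ μ ν jj, BoundedBackgroundM L M (zB L M c e V μ ν jj) α β) :
    PerturbationLaws (fun k => calDalev L M a ha k ⊗ₖ (1 : Matrix ι ι ℂ)) (deltaPrime₂ L M c e V) (fun k => JpcT L M k ⊗ₖ (1 : Matrix ι ι ℂ))
      (kappaDP2 d a α) (fun k => CDP2 d a α β * ((L : ℝ)⁻¹) ^ k) := by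
  have h := perturbationLaws_deltaPrime₂ L M a ha c e V hF hB
  have hhalf : ‖(1 / 2 : ℂ)‖ = 1 / 2 := by simp
  refine perturbationLaws_mono h (le_of_eq ?_) fun k => le_of_eq ?_
  · simp only [hhalf, Finset.sum_const, kappaDP2]; ring
  · simp only [hhalf, Finset.sum_const, CDP2]; ring

/-- **THE η-RATE FOR THE HODGE-FORM TIER-B OPERATOR PLUS THE COMMUTATOR BLOCK OF (3.10)'s `Δ′`** (`L ≥ 2`, `d ≥ 1`), at the ADJOINT site transporters
`Rb := adRep hF ∘ V` (`AdjointFieldInstance.adRep`, [B9] «R(U)X = UXU⁻¹») of a `U(N)`-valued bond-field tower `V` (colour `ι` = the component family's index): for every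
coupling `t` in the Neumann disc `‖t‖·(κ_H + κ₂) < 1`,
`TowerLimitRate (Qlev ⊗ 1) L^d (k ↦ (Δ_a^{(k)} ⊗ 1 + t·(P_B k + hodgeCorr k + Δ′₂ k))⁻¹) (Cpert (κ_H + κ₂) (2dCst) CJ (C₂^H + C₂′) 0 t) L⁻¹`.
DISPLAYED binders: `hreg₂ : RegularSites (Ad ∘ V) α β β₂` ((3.35)+(3.36) shapes on the adjoint transporters), `hNE3₂` (node NE3 BY NAME on `regClass₂`, OPEN), `0 < a′`,
the B4 thresholds, the mixed-shift `ShiftLaws` `hS`, and `BoundedBackgroundM` of the `Δ′₂` catalogue fields `zF`/`zB` (their size half is `DeltaPrimeCatalogue.norm_zF_zB_le`;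
the consistency half is node NE3's currency, R13 file 3) — NOTHING ELSE.  By `DictionaryB0.hodgeTierB_eq_principalB9` the operator is «principal part of (3.26) at
`R = Ad V` + the free averaging term + `avgPert` + the commutator block of `Δ′`»: print's `Δ_a(U)` up to the second-order block of `Δ′` and the averaging residual (r2).
MODEL LEVEL (`V` DATA, not asserted to be Bałaban's minimiser); NE2 (U1a) NOT proved by this; 0/9 unchanged.
[cite: Balaban1985BackgroundPropagators, (3.10) p.392, (3.26) p.395 (shapes)] [folklore] -/
theorem balaban_hodge_deltaPrime₂_rate {Pc : Submodule ℝ (Matrix n n ℂ)} (hF : CompFamily c Pc e) (hL : 2 ≤ L) (hd : 1 ≤ d)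
    (V : (k : ℕ) → Fin d → Tor (fine (lev L k) M) → Matrix.unitaryGroup n ℂ)
    {α β β₂ : ℝ} (hreg₂ : RegularSites L M (fun k ν x => adRep hF (V k ν x)) α β β₂) {C : ℝ} (hC : 0 ≤ C)
    (hNE3₂ : LocalRate (bgReadings L M (regClass₂ L M (fun k ν x => adRep hF (V k ν x)))) C ((L : ℝ)⁻¹)) {a' : ℝ} (ha' : 0 < a')
    (hκ : kappaS d a' α β (tauR d α) < 1)
    (hsmall : ((sigma0 d a') ^ 2)⁻¹ * deltaK (gS d a' (kappaS d a' α β (tauR d α))) (1 + tauR d α) (d * α) (tauR d α) a' < 1)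
    {cm : ℝ} (hS : ∀ μ ν, ShiftLaws L M a ha (fun k => ((shiftM (fine (lev L k) M) μ)ᴴ * shiftM (fine (lev L k) M) ν) ⊗ₖ (1 : Matrix ι ι ℂ)) cm)
    {αz βz : ℝ} (hFz : ∀ μ ν jj, BoundedBackgroundM L M (zF L M c e (fun k ν x => (V k ν x : Matrix n n ℂ)) μ ν jj) αz βz)
    (hBz : ∀ μ ν jj, BoundedBackgroundM L M (zB L M c e (fun k ν x => (V k ν x : Matrix n n ℂ)) μ ν jj) αz βz)
    {t : ℂ} (ht : ‖t‖ * ((kappaBs ι d a α β (a * (epsR ι d α * (2 + epsR ι d α) * Cst d a)) (kappa4F d a a' α β)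
      + (d : ℝ) ^ 2 * ((2 * β + 2 * α ^ 2) * Cst d a)) + kappaDP2 d a αz) < 1) :
    TowerLimitRate (fun k => Qlev L M k ⊗ₖ (1 : Matrix ι ι ℂ)) ((L : ℝ) ^ d)
      (fun k => (calDalev L M a ha k ⊗ₖ (1 : Matrix ι ι ℂ)
        + t • (balabanPert L M a (liftR L M (fun k ν x => adRep hF (V k ν x)))
              (gaugeSlot L M (fun k ν x => adRep hF (V k ν x))
                (QuT L M ι (siteT L M (fun k ν x => adRep hF (V k ν x)))) (Q1 L M ι) a') k
            + hodgeCorr L M (fun k ν x => adRep hF (V k ν x)) k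
            + deltaPrime₂ L M c e (fun k ν x => (V k ν x : Matrix n n ℂ)) k))⁻¹)
      (Cpert ((kappaBs ι d a α β (a * (epsR ι d α * (2 + epsR ι d α) * Cst d a)) (kappa4F d a a' α β)
          + (d : ℝ) ^ 2 * ((2 * β + 2 * α ^ 2) * Cst d a)) + kappaDP2 d a αz) (2 * d * Cst d a) (CJ d a)
        ((C2Bs ι d L a α β (betaNE3 ι C + β₂)
            (a * C2gram (Cst d a) 1 (epsR ι d α) (2 * d * Cst d a) (CJ d a) (Cst d a)
              (CdeltaR ι d a α (theta0 d α (betaNE3 ι (betaNE3 ι C + β₂)))))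
            (C4F ι d L a a' α β (betaNE3 ι C + β₂))
          + (d : ℝ) ^ 2 * (Cst d a * ((2 * β + 2 * α ^ 2) * cm + (2 * (betaNE3 ι C + β₂) + 4 * α * (betaNE3 ι C + β)) * Cst d a)))
          + CDP2 d a αz βz)
        0 t) ((L : ℝ)⁻¹) := by
  have hlaw := perturbationLaws_balaban_hodge L M a ha hd hreg₂ hC hNE3₂ ha' hκ hsmall hS
  rw [kappaQ_ofReal ha.le] at hlaw
  have h₂ := perturbationLaws_deltaPrime₂' L M a ha c e (fun k ν x => (V k ν x : Matrix n n ℂ)) hFz hBz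
  have hsum := perturbationLaws_add hlaw h₂
  exact towerLimitRate_perturbed_king_kron L M a ha hL (perturbationLaws_mono hsum le_rfl fun k => le_of_eq (by ring)) ht

end Summit.QuantumFields.BalabanUV.T4Continuum.NE2.DeltaPrimeHodgeRate


end
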